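/-
Copyright (c) 2026. All rights reserved.
Released under Apache 2.0 license as described in the file LICENSE.
Authors: abc-iut cell, wave-4 seat abc-iut-w4-d059 (proof-only; row T54-0b of sub-DAG SemiAnbd-Thm54:
the arithmetic decomposition group of a vertex — a commensurator — is the stabiliser of the vertex
system; instance of `mem_commensurator_map_iff_fixes` over the produced data `decompositionDataOfChart`).
-/
import Literature.AnabelianGeometry.SemiGraphs.ArithCommensuratorStabilizer
import Literature.AnabelianGeometry.SemiGraphs.TemperedVerticialCommensurable
import Literature.AnabelianGeometry.SemiGraphs.ArithDecompositionData
import HarnessLib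

/-!
# [SemiAnbd] §5 p. 65 / Thm 5.4 (i): `Π^temp_{𝔊,v}` (the commensurator of `Π^temp_{𝔾,v}`) is the
# stabiliser of the tree-vertex system of `v` — fields (AI1) `fix` and (AI2) `stab` of the arithmetic
# level data for the PRODUCED decomposition data (proof-only)

Mochizuki, *Semi-graphs of anabelioids*, Publ. RIMS **42** (2006), §5 p. 65: "`Π^temp_{𝔊,v}` … may be
thought of as the commensurator in `Π^temp_𝔊` of `Π^temp_{𝔾,v}` [Cor 2.7 (i), (iii); Prop 3.6 (iii)]", and
the proof of Thm 5.4 (i) p. 66 ("entirely similar to … Theorem 3.7 (iii)": the decomposition groups are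
the stabilisers of the vertices of the trees `T_j`). [cite: MochizukiSemiAnbd2006, Thm 5.4 (i), p. 66]

PROOF-ONLY companion (abc-iut cell, L3 sub-DAG `plan/L3/SUBDAG-SemiAnbd-Thm54.md`, row **T54-0b**
`arithVertGp_eq_stabilizer`, ruling abc-iut-L3-lead gen 3 γ3-6 (a) / ζ3-1; producer abc-iut-w4-d053,
coordinator abc-iut-w4-d085).  No definition, no new named fact.  Over abc-iut-w4-d053's PRODUCED data
`decompositionDataOfChart R ι` (`ArithDecompositionData.lean`: `Π^temp_{𝔊,v} := arithVertGp R ι v :=` the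
commensurator in `Gtp` of `ι(Π^temp_{𝔾,v})`) and LOOSE binders for the arithmetic tree system of the proof
of Thm 5.4 (trees `T j`, actions `ρ j : Gtp → Aut (T j)`, equivariant transitions `f`), exactly the
binders of `ArithCommensuratorStabilizer.lean` / the fields of abc-iut-w4-d053's `ArithLevelData`:

* `mem_commensurator_map_iff_fixes_of_mem_verticialSubgroups` / `mem_arithVertGp_iff_fixes`: for a §3
  verticial subgroup `H` (resp. the chosen representative `R.Hv v`) which is the full `Π^temp_𝔾`-stabiliser
  of a compatible system `x` of tree vertices, `g ∈ C_{Gtp}(ι H)` (resp. `g ∈ arithVertGp R ι v`) IFF `g`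
  fixes `x` — the instance of the generic core `mem_commensurator_map_iff_fixes` (p414245) with
  `VN :=` all §3 verticial subgroups, whose input `hrigid` (Thm 3.7 (ii): commensurable verticial subgroups
  coincide) is DISCHARGED by `verticial_commensurable_rigid` (p414476, from `verticialDistinct_holds`);
* `fix_decompositionDataOfChart` / `stab_decompositionDataOfChart`: the TWO-SIDED fields (AI1) `fix` and
  (AI2) `stab` of the arithmetic level data for `D := decompositionDataOfChart R ι`, `act := ρ`: the
  verticial subgroups of `D` (conjugates of the `arithVertGp R ι v`) are EXACTLY the full `Gtp`-stabilisers
  of compatible systems of tree vertices.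

What is taken as INPUT (hypotheses, never `def … : Prop`): `ι` injective with normal image (Prop 5.2 (iv):
`ι(Π^temp_𝔾) = ker aug`), equivariance of the transitions (`hequiv`), and the GEOMETRIC dictionary for the
RESTRICTED action `n ↦ ρ j (ι n)` of `Π^temp_𝔾` on the same trees — (`hfixN`) every §3 verticial subgroup
IS the full stabiliser of some compatible vertex system, (`hstabN`) the full stabiliser of every compatible
vertex system IS a §3 verticial subgroup (the two-sided forms of the fields `fix`/`stab` of abc-iut-L3-t10's
`VerticialLevelData`, proof of Thm 3.7 (iii) p. 41), (`huniqN`) a verticial subgroup fixes at most one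
compatible system (a verticial subgroup lies in no edge-like one; to be discharged separately by a
König-type argument).  Producing these for the Galois tower of `B^temp(𝔊)` is the producer row T54-B.
Nothing here takes a side on [IUTchIII] Cor. 3.12; typed ≠ proved elsewhere.
-/

namespace Literature.AnabelianGeometry.SemiGraphs

namespace ProfiniteSemiGraph

open CategoryTheory
open scoped Pointwise

universe v u u' w

variable {𝒢 : ProfiniteSemiGraph.{u}} {c : TemperedPiChart 𝒢} {Gtp : Type u'} [Group Gtp]
  (ι : c.G →* Gtp) {J : Type v} [Preorder J] (T : J → SemiGraph.{w}) (ρ : ∀ j, Gtp →* Aut (T j))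
  (f : ∀ ⦃i j : J⦄, i ≤ j → (T j ⟶ T i))

/-! ### Bookkeeping: conjugates of stabilisers -/

omit [Preorder J] in
/-- Membership in a conjugate subgroup (t3's `conjSubgroup g K = g K g⁻¹`). [folklore] -/
private theorem mem_conjSubgroup_iff' {g y : Gtp} {K : Subgroup Gtp} :
    y ∈ conjSubgroup g K ↔ g⁻¹ * y * g ∈ K := by
  constructor
  · rintro ⟨z, hz, rfl⟩
    simpa [MulAut.conj_apply, mul_assoc] using hz
  · intro h
    exact ⟨g⁻¹ * y * g, h, by simp [MulAut.conj_apply, mul_assoc]⟩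

omit [Preorder J] in
/-- **The conjugate of a full stabiliser is the full stabiliser of the translate**: if
`S = {y | y fixes x}` then `g S g⁻¹ = {y | y fixes g·x}`. [cite: MochizukiSemiAnbd2006, Thm 5.4 (i), p. 66] -/
theorem mem_conjSubgroup_stabilizer_iff {S : Subgroup Gtp} {x : ∀ j, (T j).Vertex}
    (hS : ∀ y : Gtp, y ∈ S ↔ ∀ j, (ρ j y).hom.vertexMap (x j) = x j) (g y : Gtp) :
    y ∈ conjSubgroup g S ↔
      ∀ j, (ρ j y).hom.vertexMap ((ρ j g).hom.vertexMap (x j)) = (ρ j g).hom.vertexMap (x j) := by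
  rw [mem_conjSubgroup_iff', hS]
  refine forall_congr' fun j => ?_
  rw [act_mul_vertexMap, act_mul_vertexMap]
  constructor
  · intro h
    -- apply `g` to `g⁻¹ (y (g x)) = x`
    have := congrArg ((ρ j g).hom.vertexMap) h
    rwa [act_act_inv_vertexMap] at this
  · intro h
    rw [h, act_inv_act_vertexMap]

/-! ### The commensurator of the image of a verticial subgroup is the arithmetic stabiliser -/

/-- **`C_{Gtp}(ι H)` is the stabiliser of the vertex system of `H`**, for EVERY §3 verticial subgroup `H`
which is the full `Π^temp_𝔾`-stabiliser of a compatible system `x` of tree vertices ([SemiAnbd] §5 p. 65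
"[Cor 2.7 (i), (iii); Prop 3.6 (iii)]"; the instance of `mem_commensurator_map_iff_fixes` with `VN :=` the
§3 verticial subgroups, `hrigid` discharged by Thm 3.7 (ii) `verticial_commensurable_rigid`).
[cite: MochizukiSemiAnbd2006, §5, p. 65] -/
theorem mem_commensurator_map_iff_fixes_of_mem_verticialSubgroups (h𝒢 : 𝒢.Thm37Hypotheses)
    (hι : Function.Injective ι) (hnorm : (ι.range).Normal)
    (hequiv : ∀ ⦃i j : J⦄ (h : i ≤ j) (g : Gtp) (y : (T j).Vertex),
      (f h).vertexMap ((ρ j g).hom.vertexMap y) = (ρ i g).hom.vertexMap ((f h).vertexMap y))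
    (hstabN : ∀ x : ∀ j, (T j).Vertex, (∀ ⦃i j : J⦄ (h : i ≤ j), (f h).vertexMap (x j) = x i) →
      ∃ (v : 𝒢.graph.Vertex) (H : Subgroup c.G), H ∈ verticialSubgroups c v ∧
        ∀ n : c.G, n ∈ H ↔ ∀ j, (ρ j (ι n)).hom.vertexMap (x j) = x j)
    (huniqN : ∀ (v : 𝒢.graph.Vertex) (H : Subgroup c.G), H ∈ verticialSubgroups c v →
      ∀ x x' : ∀ j, (T j).Vertex,
      (∀ ⦃i j : J⦄ (h : i ≤ j), (f h).vertexMap (x j) = x i) →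
      (∀ ⦃i j : J⦄ (h : i ≤ j), (f h).vertexMap (x' j) = x' i) →
      (∀ n ∈ H, ∀ j, (ρ j (ι n)).hom.vertexMap (x j) = x j) →
      (∀ n ∈ H, ∀ j, (ρ j (ι n)).hom.vertexMap (x' j) = x' j) → x = x')
    {v : 𝒢.graph.Vertex} {H : Subgroup c.G} (hH : H ∈ verticialSubgroups c v)
    {x : ∀ j, (T j).Vertex} (hx : ∀ ⦃i j : J⦄ (h : i ≤ j), (f h).vertexMap (x j) = x i)
    (hHx : ∀ n : c.G, n ∈ H ↔ ∀ j, (ρ j (ι n)).hom.vertexMap (x j) = x j) (g : Gtp) :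
    g ∈ Subgroup.Commensurable.commensurator (H.map ι) ↔ ∀ j, (ρ j g).hom.vertexMap (x j) = x j :=
  mem_commensurator_map_iff_fixes ι T ρ f hι hnorm hequiv
    {H : Subgroup c.G | ∃ v, H ∈ verticialSubgroups c v}
    (fun x hx => by
      obtain ⟨v, H, hH, h⟩ := hstabN x hx
      exact ⟨H, ⟨v, hH⟩, h⟩)
    (verticial_commensurable_rigid verticialDistinct_holds h𝒢 c)
    (by
      rintro H ⟨v, hH⟩ x x' hx hx' h h'
      exact huniqN v H hH x x' hx hx' h h')
    ⟨v, hH⟩ hx hHx g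

/-- **Row T54-0b `arithVertGp_eq_stabilizer`: the arithmetic decomposition group `Π^temp_{𝔊,v}` of p. 65 —
DEFINED as the commensurator `arithVertGp R ι v` of `ι(Π^temp_{𝔾,v})` — is the stabiliser in `Π^temp_𝔊` of
the compatible tree-vertex system `x` of `v`** (the system of which the chosen representative `R.Hv v` is
the full `Π^temp_𝔾`-stabiliser): `g ∈ arithVertGp R ι v ↔ g` fixes `x`.
[cite: MochizukiSemiAnbd2006, §5, p. 65] -/
theorem mem_arithVertGp_iff_fixes (h𝒢 : 𝒢.Thm37Hypotheses) (R : ChartRepresentatives c)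
    (hι : Function.Injective ι) (hnorm : (ι.range).Normal)
    (hequiv : ∀ ⦃i j : J⦄ (h : i ≤ j) (g : Gtp) (y : (T j).Vertex),
      (f h).vertexMap ((ρ j g).hom.vertexMap y) = (ρ i g).hom.vertexMap ((f h).vertexMap y))
    (hstabN : ∀ x : ∀ j, (T j).Vertex, (∀ ⦃i j : J⦄ (h : i ≤ j), (f h).vertexMap (x j) = x i) →
      ∃ (v : 𝒢.graph.Vertex) (H : Subgroup c.G), H ∈ verticialSubgroups c v ∧
        ∀ n : c.G, n ∈ H ↔ ∀ j, (ρ j (ι n)).hom.vertexMap (x j) = x j)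
    (huniqN : ∀ (v : 𝒢.graph.Vertex) (H : Subgroup c.G), H ∈ verticialSubgroups c v →
      ∀ x x' : ∀ j, (T j).Vertex,
      (∀ ⦃i j : J⦄ (h : i ≤ j), (f h).vertexMap (x j) = x i) →
      (∀ ⦃i j : J⦄ (h : i ≤ j), (f h).vertexMap (x' j) = x' i) →
      (∀ n ∈ H, ∀ j, (ρ j (ι n)).hom.vertexMap (x j) = x j) →
      (∀ n ∈ H, ∀ j, (ρ j (ι n)).hom.vertexMap (x' j) = x' j) → x = x')
    {v : 𝒢.graph.Vertex} {x : ∀ j, (T j).Vertex}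
    (hx : ∀ ⦃i j : J⦄ (h : i ≤ j), (f h).vertexMap (x j) = x i)
    (hvx : ∀ n : c.G, n ∈ R.Hv v ↔ ∀ j, (ρ j (ι n)).hom.vertexMap (x j) = x j) (g : Gtp) :
    g ∈ arithVertGp R ι v ↔ ∀ j, (ρ j g).hom.vertexMap (x j) = x j :=
  mem_commensurator_map_iff_fixes_of_mem_verticialSubgroups ι T ρ f h𝒢 hι hnorm hequiv hstabN huniqN
    (R.Hv_mem v) hx hvx g

/-! ### The two-sided fields (AI1) `fix` and (AI2) `stab` for the produced data -/

/-- **Field (AI1) `fix` of the arithmetic level data, for the PRODUCED data** (Thm 5.4 (i) p. 66 via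
Thm 3.7 (iii) p. 41): every verticial subgroup of `decompositionDataOfChart R ι` — a conjugate
`g₀ · Π^temp_{𝔊,v} · g₀⁻¹` — IS the full stabiliser of a compatible system of tree vertices (namely of the
translate `g₀ · x_v`).  Inputs: the geometric two-sided dictionary `hfixN`/`hstabN`/`huniqN` for the
restricted action. [cite: MochizukiSemiAnbd2006, Thm 5.4 (i), p. 66] -/
theorem fix_decompositionDataOfChart (h𝒢 : 𝒢.Thm37Hypotheses) (R : ChartRepresentatives c)
    (hι : Function.Injective ι) (hnorm : (ι.range).Normal)
    (hequiv : ∀ ⦃i j : J⦄ (h : i ≤ j) (g : Gtp) (y : (T j).Vertex),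
      (f h).vertexMap ((ρ j g).hom.vertexMap y) = (ρ i g).hom.vertexMap ((f h).vertexMap y))
    (hfixN : ∀ (v : 𝒢.graph.Vertex) (H : Subgroup c.G), H ∈ verticialSubgroups c v →
      ∃ x : ∀ j, (T j).Vertex, (∀ ⦃i j : J⦄ (h : i ≤ j), (f h).vertexMap (x j) = x i) ∧
        ∀ n : c.G, n ∈ H ↔ ∀ j, (ρ j (ι n)).hom.vertexMap (x j) = x j)
    (hstabN : ∀ x : ∀ j, (T j).Vertex, (∀ ⦃i j : J⦄ (h : i ≤ j), (f h).vertexMap (x j) = x i) →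
      ∃ (v : 𝒢.graph.Vertex) (H : Subgroup c.G), H ∈ verticialSubgroups c v ∧
        ∀ n : c.G, n ∈ H ↔ ∀ j, (ρ j (ι n)).hom.vertexMap (x j) = x j)
    (huniqN : ∀ (v : 𝒢.graph.Vertex) (H : Subgroup c.G), H ∈ verticialSubgroups c v →
      ∀ x x' : ∀ j, (T j).Vertex,
      (∀ ⦃i j : J⦄ (h : i ≤ j), (f h).vertexMap (x j) = x i) →
      (∀ ⦃i j : J⦄ (h : i ≤ j), (f h).vertexMap (x' j) = x' i) →
      (∀ n ∈ H, ∀ j, (ρ j (ι n)).hom.vertexMap (x j) = x j) →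
      (∀ n ∈ H, ∀ j, (ρ j (ι n)).hom.vertexMap (x' j) = x' j) → x = x')
    (W : Subgroup Gtp) (hW : IsVerticial (decompositionDataOfChart R ι) W) :
    ∃ x : ∀ j, (T j).Vertex, (∀ ⦃i j : J⦄ (h : i ≤ j), (f h).vertexMap (x j) = x i) ∧
      ∀ g : Gtp, g ∈ W ↔ ∀ j, (ρ j g).hom.vertexMap (x j) = x j := by
  obtain ⟨v, g₀, rfl⟩ := hW
  -- the vertex system of the representative `R.Hv v`
  obtain ⟨x, hx, hvx⟩ := hfixN v (R.Hv v) (R.Hv_mem v)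
  -- `Π^temp_{𝔊,v}` is its full stabiliser; the conjugate is the stabiliser of the translate
  have hS : ∀ y : Gtp, y ∈ arithVertGp R ι v ↔ ∀ j, (ρ j y).hom.vertexMap (x j) = x j :=
    mem_arithVertGp_iff_fixes ι T ρ f h𝒢 R hι hnorm hequiv hstabN huniqN hx hvx
  refine ⟨fun j => (ρ j g₀).hom.vertexMap (x j), compatible_translate T ρ f hequiv hx g₀, fun g => ?_⟩
  rw [decompositionDataOfChart_vertGp]
  exact mem_conjSubgroup_stabilizer_iff T ρ hS g₀ g

/-- Conjugation by `1` is the identity on subgroups. [folklore] -/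
private theorem conjSubgroup_one'' (K : Subgroup Gtp) : conjSubgroup 1 K = K := by
  ext y
  simp [mem_conjSubgroup_iff']

/-- **Field (AI2) `stab` of the arithmetic level data, for the PRODUCED data** (Thm 5.4 (i) p. 66 via
Thm 3.7 (iii) p. 41): the full `Π^temp_𝔊`-stabiliser of every compatible system of tree vertices IS a
verticial subgroup of `decompositionDataOfChart R ι` — namely `C_{Π^temp_𝔊}(ι H)` for the §3 verticial
subgroup `H` stabilising the system in `Π^temp_𝔾`, verticial for the produced data by abc-iut-w4-d053's
`isVerticial_decompositionDataOfChart_iff`. [cite: MochizukiSemiAnbd2006, Thm 5.4 (i), p. 66] -/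
theorem stab_decompositionDataOfChart (h𝒢 : 𝒢.Thm37Hypotheses) (R : ChartRepresentatives c)
    (hι : Function.Injective ι) (hnorm : (ι.range).Normal)
    (hequiv : ∀ ⦃i j : J⦄ (h : i ≤ j) (g : Gtp) (y : (T j).Vertex),
      (f h).vertexMap ((ρ j g).hom.vertexMap y) = (ρ i g).hom.vertexMap ((f h).vertexMap y))
    (hstabN : ∀ x : ∀ j, (T j).Vertex, (∀ ⦃i j : J⦄ (h : i ≤ j), (f h).vertexMap (x j) = x i) →
      ∃ (v : 𝒢.graph.Vertex) (H : Subgroup c.G), H ∈ verticialSubgroups c v ∧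
        ∀ n : c.G, n ∈ H ↔ ∀ j, (ρ j (ι n)).hom.vertexMap (x j) = x j)
    (huniqN : ∀ (v : 𝒢.graph.Vertex) (H : Subgroup c.G), H ∈ verticialSubgroups c v →
      ∀ x x' : ∀ j, (T j).Vertex,
      (∀ ⦃i j : J⦄ (h : i ≤ j), (f h).vertexMap (x j) = x i) →
      (∀ ⦃i j : J⦄ (h : i ≤ j), (f h).vertexMap (x' j) = x' i) →
      (∀ n ∈ H, ∀ j, (ρ j (ι n)).hom.vertexMap (x j) = x j) →
      (∀ n ∈ H, ∀ j, (ρ j (ι n)).hom.vertexMap (x' j) = x' j) → x = x')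
    (x : ∀ j, (T j).Vertex) (hx : ∀ ⦃i j : J⦄ (h : i ≤ j), (f h).vertexMap (x j) = x i) :
    ∃ W : Subgroup Gtp, IsVerticial (decompositionDataOfChart R ι) W ∧
      ∀ g : Gtp, g ∈ W ↔ ∀ j, (ρ j g).hom.vertexMap (x j) = x j := by
  obtain ⟨v, H, hH, hHx⟩ := hstabN x hx
  refine ⟨Subgroup.Commensurable.commensurator (H.map ι), ?_, fun g =>
    mem_commensurator_map_iff_fixes_of_mem_verticialSubgroups ι T ρ f h𝒢 hι hnorm hequiv hstabN huniqN
      hH hx hHx g⟩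
  rw [isVerticial_decompositionDataOfChart_iff]
  exact ⟨v, H, 1, hH, (conjSubgroup_one'' _).symm⟩

/-- **Both directions at once** (the verticial subgroups of the produced data are EXACTLY the full
stabilisers of compatible tree-vertex systems) — the form in which abc-iut-w4-d053's `ArithLevelData`
records (AI1)+(AI2). [cite: MochizukiSemiAnbd2006, Thm 5.4 (i), p. 66] -/
theorem isVerticial_decompositionDataOfChart_iff_exists_stabilizer (h𝒢 : 𝒢.Thm37Hypotheses)
    (R : ChartRepresentatives c) (hι : Function.Injective ι) (hnorm : (ι.range).Normal)
    (hequiv : ∀ ⦃i j : J⦄ (h : i ≤ j) (g : Gtp) (y : (T j).Vertex),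
      (f h).vertexMap ((ρ j g).hom.vertexMap y) = (ρ i g).hom.vertexMap ((f h).vertexMap y))
    (hfixN : ∀ (v : 𝒢.graph.Vertex) (H : Subgroup c.G), H ∈ verticialSubgroups c v →
      ∃ x : ∀ j, (T j).Vertex, (∀ ⦃i j : J⦄ (h : i ≤ j), (f h).vertexMap (x j) = x i) ∧
        ∀ n : c.G, n ∈ H ↔ ∀ j, (ρ j (ι n)).hom.vertexMap (x j) = x j)
    (hstabN : ∀ x : ∀ j, (T j).Vertex, (∀ ⦃i j : J⦄ (h : i ≤ j), (f h).vertexMap (x j) = x i) →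
      ∃ (v : 𝒢.graph.Vertex) (H : Subgroup c.G), H ∈ verticialSubgroups c v ∧
        ∀ n : c.G, n ∈ H ↔ ∀ j, (ρ j (ι n)).hom.vertexMap (x j) = x j)
    (huniqN : ∀ (v : 𝒢.graph.Vertex) (H : Subgroup c.G), H ∈ verticialSubgroups c v →
      ∀ x x' : ∀ j, (T j).Vertex,
      (∀ ⦃i j : J⦄ (h : i ≤ j), (f h).vertexMap (x j) = x i) →
      (∀ ⦃i j : J⦄ (h : i ≤ j), (f h).vertexMap (x' j) = x' i) →
      (∀ n ∈ H, ∀ j, (ρ j (ι n)).hom.vertexMap (x j) = x j) →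
      (∀ n ∈ H, ∀ j, (ρ j (ι n)).hom.vertexMap (x' j) = x' j) → x = x')
    (W : Subgroup Gtp) :
    IsVerticial (decompositionDataOfChart R ι) W ↔
      ∃ x : ∀ j, (T j).Vertex, (∀ ⦃i j : J⦄ (h : i ≤ j), (f h).vertexMap (x j) = x i) ∧
        ∀ g : Gtp, g ∈ W ↔ ∀ j, (ρ j g).hom.vertexMap (x j) = x j := by
  constructor
  · exact fix_decompositionDataOfChart ι T ρ f h𝒢 R hι hnorm hequiv hfixN hstabN huniqN W
  · rintro ⟨x, hx, hW⟩
    obtain ⟨W', hW', hW'x⟩ := stab_decompositionDataOfChart ι T ρ f h𝒢 R hι hnorm hequiv hstabN huniqN x hx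
    have : W = W' := by
      ext g; rw [hW g, hW'x g]
    rw [this]
    exact hW'

end ProfiniteSemiGraph

end Literature.AnabelianGeometry.SemiGraphs
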